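import Literature.AnabelianGeometry.Anabelioids.TrivialObjectSections

/-!
# The fibre of a trivial object `∐_J 1` of a Galois category has `|J|` points

Mathlib-level lemmas for the anabelioid dictionary ([SGA1, Exp. V §4–5]), complementing
`TrivialObjectSections.lean`: for a fibre functor `F` of a Galois category `C`, a finite set of
sheets `J` (any universe) and the point `t` of `F 1`,

* `TrivialObj.map_ι_injective`: distinct sheets have distinct fibre points `F(ι_j)(t)`;
* `TrivialObj.card_fiber`: hence `|F(∐_J 1)| = |J|` (every fibre point is the point of a sheet).

In the proof of [SemiAnbd] Proposition 2.6 (p. 29) this is "the finite `Π_𝒢`-set of a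
graph-covering of degree `M` has `M` points over each vertex".  Proof-only, no definitions.
-/

namespace Literature.AnabelianGeometry.Anabelioids

namespace TrivialObj

open CategoryTheory CategoryTheory.Limits CategoryTheory.PreGaloisCategory

universe w w' u₂ u₁

variable {C : Type u₁} [Category.{u₂} C] [GaloisCategory C] {J : Type w'} [Finite J]
variable (F : C ⥤ FintypeCat.{w}) [FiberFunctor F]

/-- **Distinct sheets have distinct fibre points.** [cite: SGA1, Exp. V §5] -/
theorem map_ι_injective (t : F.obj (⊤_ C)) :
    Function.Injective fun j : J => F.map (Sigma.ι (fun _ : J => ⊤_ C) j) t := by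
  intro j j' h
  haveI : Mono (Sigma.ι (fun _ : J => ⊤_ C) j') :=
    MonoCoprod.mono_inj (fun _ : J => ⊤_ C) (colimit.cocone (Discrete.functor fun _ : J => ⊤_ C))
      (colimit.isColimit _) j'
  haveI : Mono (Sigma.ι (fun _ : J => ⊤_ C) j) :=
    MonoCoprod.mono_inj (fun _ : J => ⊤_ C) (colimit.cocone (Discrete.functor fun _ : J => ⊤_ C))
      (colimit.isColimit _) j
  -- the sheet `j` lies in the sheet `j'` (read on the fibre), hence `ι_j = ι_{j'}`
  obtain ⟨f, hf⟩ := (factors_iff_mem_range (F := F) (Sigma.ι (fun _ : J => ⊤_ C) j') j t).mpr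
    ⟨t, h.symm⟩
  have hf1 : f = 𝟙 _ := terminal.hom_ext _ _
  rw [hf1, Category.id_comp] at hf
  -- distinct summands of `∐_J 1` are distinct subobjects
  have hmk : Subobject.mk (Sigma.ι (fun _ : J => ⊤_ C) j) =
      Subobject.mk (Sigma.ι (fun _ : J => ⊤_ C) j') :=
    Subobject.mk_eq_mk_of_comm _ _ (Iso.refl _) (by rw [Iso.refl_hom, Category.id_comp, hf])
  exact subobjectMk_sigma_ι_injective J hmk

/-- **`|F(∐_J 1)| = |J|`.** [cite: SGA1, Exp. V §5] -/
theorem card_fiber : Nat.card (F.obj (∐ fun _ : J => ⊤_ C)) = Nat.card J := by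
  obtain ⟨t⟩ := (nonempty_equiv_fiber_terminal_punit F).map fun e => e.symm PUnit.unit
  refine (Nat.card_eq_of_bijective (fun j : J => F.map (Sigma.ι (fun _ : J => ⊤_ C) j) t)
    ⟨map_ι_injective F t, fun x => ?_⟩).symm
  obtain ⟨j, rfl⟩ := exists_eq_map_ι F t x
  exact ⟨j, rfl⟩

end TrivialObj

end Literature.AnabelianGeometry.Anabelioids
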